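import Mathlib
import Summits.NavierStokesRegularity.NavierStokesRegularity.Theorems.FilamentSkeletonRssDefectColumnGateAzimuthalBlockCoreBdry

/-!
# Route `FilamentSkeletonRss` · crux `TransverseReduction1AG` (stmt-NavierStokesRegularity-27853; A1L twin stmt-23297) · line
# `defect_column_gate_1AG/1AL` — the TRUNCATED-CORE CURRENCY bounds for the Biot–Savart-coupled azimuthal blocks `m ≥ 2` of S2a-loc
# `WaistColumnGateLoc1A` (stage 1b of the two-zone assembly)

Helper file (`--supports stmt-NavierStokesRegularity-27853 --as helper`; seat ns-filament-s2aloc-p1 g2; note ARCHITECTURE-B2B3-s2aloc-g2.md v3 §7b,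
trap (T2′)).  Same chain as `coreTrunc_sup_sq_le` (`…CoreBdry.lean`), but the conclusion is the pair of bounds for the Gaussian currencies
`IE = ∫₀^{u₁}E(a²+b²)` and `D + D₂ = ∫₀^{u₁}E(4u(a₁²+b₁²) + m²(a²+b²)/u)` in terms of the forcing size `M`, the boundary fluxes `B₁, B₂` at `u₁`
and the exterior Biot–Savart remainder `X = ∫_{u₁}^U u(a²+b²)`.  The two-zone assembly extracts the exterior lemma's inner datum `s(u₀)` from
`[u₀ − 1/γ, u₀]` with `sq_le_extraction_short` against THESE currencies (full Gaussian discount `e^{1/4}/E(u₀)`), which is what closes the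
bootstrap; the sup bound alone does not.
HONEST FRAMING: a-priori bounds for ONE family of blocks of ONE linear MODEL operator of a hypothetical blow-up route (MODEL rung, negative side);
nothing here bears on NS regularity.
-/

set_option linter.dupNamespace false

noncomputable section

namespace Summit.NavierStokesRegularity.NavierStokesRegularity.Theorems.DefectColumnGate

open scoped Topology
open Set Filter MeasureTheory intervalIntegral

set_option maxHeartbeats 1600000 in
/-- **Truncated-core CURRENCY bounds (`m ≥ 2`)** — the same chain as `coreTrunc_sup_sq_le`, exporting the bounds of the Gaussian currencies
themselves: `IE = ∫₀^{u₁}E(a²+b²) ≤ K·𝒞♭` and `D + D₂ = ∫₀^{u₁}E(4u(a₁²+b₁²) + m²(a²+b²)/u) ≤ DD♭`, with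
`𝒞♭ = 4K·M²u₁E(u₁)/(c₁²Rc²) + 4(B₁ + (γ²Rc/16πm)X)/(c₁Rc)` and `DD♭` the right-hand side of `coreTrunc_sup_sq_le`.  (The two-zone assembly needs
the currencies, not only the sup, to extract the exterior lemma's inner datum `s(u₀)` with the full Gaussian discount — trap (T2′).) -/
theorem coreTrunc_currencies_le {γ m ρ Rc u₁ U M : ℝ} {a a₁ b b₁ φa φa₁ φb φb₁ f₁ f₂ : ℝ → ℝ}
    (hγ : 0 < γ) (hm : 2 ≤ m) (hRc : 1 ≤ Rc) (hu₁ : 0 < u₁) (hu₁U : u₁ ≤ U) (hρ : 40 * Real.pi * |ρ| * (u₁ + 4 / γ) ≤ Rc)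
    (ha : ContinuousOn a (Icc 0 U)) (hb : ContinuousOn b (Icc 0 U))
    (hφa : ContinuousOn φa (Icc 0 U)) (hφb : ContinuousOn φb (Icc 0 U))
    (hΦac : ContinuousOn (fun s => 4 * s * a₁ s + γ * s * a s) (Icc 0 U))
    (hΦbc : ContinuousOn (fun s => 4 * s * b₁ s + γ * s * b s) (Icc 0 U))
    (hPac : ContinuousOn (fun s => s * φa₁ s) (Icc 0 U)) (hPbc : ContinuousOn (fun s => s * φb₁ s) (Icc 0 U))
    (ha0 : a 0 = 0) (hb0 : b 0 = 0) (hφa0 : φa 0 = 0) (hφb0 : φb 0 = 0)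
    (hdera : ∀ u ∈ Ioo 0 U, HasDerivAt a (a₁ u) u) (hderb : ∀ u ∈ Ioo 0 U, HasDerivAt b (b₁ u) u)
    (hderφa : ∀ u ∈ Ioo 0 U, HasDerivAt φa (φa₁ u) u) (hderφb : ∀ u ∈ Ioo 0 U, HasDerivAt φb (φb₁ u) u)
    (hΦa : ∀ u ∈ Ioo 0 U, HasDerivAt (fun s => 4 * s * a₁ s + γ * s * a s)
      (m ^ 2 / u * a u - m * (ρ + Rc * ((1 - Real.exp (-(γ * u / 4))) / (2 * Real.pi * u))) * b u
        + γ * m * Rc / 2 * (γ / (4 * Real.pi) * Real.exp (-(γ * u / 4))) * φb u - f₁ u) u)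
    (hΦb : ∀ u ∈ Ioo 0 U, HasDerivAt (fun s => 4 * s * b₁ s + γ * s * b s)
      (m ^ 2 / u * b u + m * (ρ + Rc * ((1 - Real.exp (-(γ * u / 4))) / (2 * Real.pi * u))) * a u
        - γ * m * Rc / 2 * (γ / (4 * Real.pi) * Real.exp (-(γ * u / 4))) * φa u - f₂ u) u)
    (hPa : ∀ u ∈ Ioo 0 U, HasDerivAt (fun s => s * φa₁ s) ((m ^ 2 / u * φa u - a u) / 4) u)
    (hPb : ∀ u ∈ Ioo 0 U, HasDerivAt (fun s => s * φb₁ s) ((m ^ 2 / u * φb u - b u) / 4) u)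
    (hφaU : φa U = 0) (hφbU : φb U = 0)
    (hf₁ : ∀ u ∈ Icc 0 U, (1 + u) ^ 2 * |f₁ u| ≤ M) (hf₂ : ∀ u ∈ Icc 0 U, (1 + u) ^ 2 * |f₂ u| ≤ M)
    (hIΩ : IntervalIntegrable (fun u => Real.exp (γ * u / 4)
      * ((1 - Real.exp (-(γ * u / 4))) / (2 * Real.pi * u)) * (a u ^ 2 + b u ^ 2)) volume 0 U)
    (hIE : IntervalIntegrable (fun u => Real.exp (γ * u / 4) * (a u ^ 2 + b u ^ 2)) volume 0 U)
    (hIf : IntervalIntegrable (fun u => Real.exp (γ * u / 4) * (a u * f₂ u - b u * f₁ u)) volume 0 U)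
    (hIg : IntervalIntegrable (fun u => Real.exp (γ * u / 4) * (a u * f₁ u + b u * f₂ u)) volume 0 U)
    (hID₁ : IntervalIntegrable (fun u => Real.exp (γ * u / 4) * (4 * u * (a₁ u ^ 2 + b₁ u ^ 2))) volume 0 U)
    (hID₂ : IntervalIntegrable (fun u => Real.exp (γ * u / 4) * (m ^ 2 / u * (a u ^ 2 + b u ^ 2))) volume 0 U)
    (hIaφ : IntervalIntegrable (fun u => a u * φa u) volume 0 U)
    (hIbφ : IntervalIntegrable (fun u => b u * φb u) volume 0 U)
    (hIBa₁ : IntervalIntegrable (fun u => 4 * u * φa₁ u ^ 2) volume 0 U)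
    (hIBa₂ : IntervalIntegrable (fun u => m ^ 2 / u * φa u ^ 2) volume 0 U)
    (hIBb₁ : IntervalIntegrable (fun u => 4 * u * φb₁ u ^ 2) volume 0 U)
    (hIBb₂ : IntervalIntegrable (fun u => m ^ 2 / u * φb u ^ 2) volume 0 U)
    (hIua : IntervalIntegrable (fun u => u * a u ^ 2) volume 0 U)
    (hIub : IntervalIntegrable (fun u => u * b u ^ 2) volume 0 U)
    (hIcross : IntervalIntegrable (fun u => b u * φa u - a u * φb u) volume 0 U) :
    (∫ u in (0:ℝ)..u₁, Real.exp (γ * u / 4) * (a u ^ 2 + b u ^ 2))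
        ≤ (2 * Real.pi * (u₁ + 4 / γ))
          * (4 * (2 * Real.pi * (u₁ + 4 / γ)) * (M ^ 2 * (u₁ * Real.exp (γ * u₁ / 4))) / (((1 - 16 / (5 * m ^ 2)) * m) ^ 2 * Rc ^ 2)
            + 4 * ((Real.exp (γ * u₁ / 4) * (a u₁ * (4 * u₁ * b₁ u₁ + γ * u₁ * b u₁) - b u₁ * (4 * u₁ * a₁ u₁ + γ * u₁ * a u₁)))
              + γ ^ 2 * Rc / (16 * Real.pi * m) * ∫ u in u₁..U, u * (a u ^ 2 + b u ^ 2)) / (((1 - 16 / (5 * m ^ 2)) * m) * Rc)) ∧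
    (∫ u in (0:ℝ)..u₁, Real.exp (γ * u / 4) * (4 * u * (a₁ u ^ 2 + b₁ u ^ 2)))
      + (∫ u in (0:ℝ)..u₁, Real.exp (γ * u / 4) * (m ^ 2 / u * (a u ^ 2 + b u ^ 2)))
      ≤ M ^ 2 * (u₁ * Real.exp (γ * u₁ / 4)) / Rc
          * (4 * (2 * Real.pi * (u₁ + 4 / γ)) * ((γ + 1) * (2 * Real.pi * (u₁ + 4 / γ)) + 4) / ((1 - 16 / (5 * m ^ 2)) * m) ^ 2 + 1 / 2)
        + 4 * ((γ + 1) * (2 * Real.pi * (u₁ + 4 / γ)) + 4)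
          * (Real.exp (γ * u₁ / 4) * (a u₁ * (4 * u₁ * b₁ u₁ + γ * u₁ * b u₁) - b u₁ * (4 * u₁ * a₁ u₁ + γ * u₁ * a u₁)))
          / ((1 - 16 / (5 * m ^ 2)) * m)
        + Real.exp (γ * u₁ / 4) * (a u₁ * (4 * u₁ * a₁ u₁ + γ * u₁ * a u₁) + b u₁ * (4 * u₁ * b₁ u₁ + γ * u₁ * b u₁)
            - γ * u₁ * (a u₁ ^ 2 + b u₁ ^ 2))
        + γ ^ 2 * Rc / (16 * Real.pi * m) * (1 + 4 * ((γ + 1) * (2 * Real.pi * (u₁ + 4 / γ)) + 4) / ((1 - 16 / (5 * m ^ 2)) * m))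
          * ∫ u in u₁..U, u * (a u ^ 2 + b u ^ 2) := by
  have hm0 : 0 < m := by linarith
  have hm0' : m ≠ 0 := hm0.ne'
  have hπ : 0 < Real.pi := Real.pi_pos
  have hRc0 : 0 < Rc := by linarith
  have hU0 : 0 ≤ U := le_trans hu₁.le hu₁U
  have hu₁0 : 0 ≤ u₁ := hu₁.le
  have hM : 0 ≤ M := le_trans (by positivity) (hf₁ 0 (left_mem_Icc.2 hU0))
  have hsub : Icc 0 u₁ ⊆ Icc 0 U := Icc_subset_Icc le_rfl hu₁U
  -- constants
  set K : ℝ := 2 * Real.pi * (u₁ + 4 / γ) with hKdef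
  have hK : 0 < K := by positivity
  set c₁ : ℝ := (1 - 16 / (5 * m ^ 2)) * m with hc₁def
  have hc₁m : m / 5 ≤ c₁ := by
    rw [hc₁def]
    have : 16 / (5 * m ^ 2) ≤ 4 / 5 := by
      rw [div_le_div_iff₀ (by positivity) (by norm_num)]; nlinarith
    nlinarith
  have hc₁ : 0 < c₁ := lt_of_lt_of_le (by positivity) hc₁m
  -- (Im) and (Re), truncated at `u₁`
  have hIm := core_rotation_coercivity_trunc hγ hm hRc0.le hu₁0 hu₁U ha hb hφa hφb hΦac hΦbc hPac hPbc hφa0 hφb0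
    hdera hderb hderφa hderφb hΦa hΦb hPa hPb hφaU hφbU hIΩ hIE hIf hIaφ hIbφ hIBa₁ hIBa₂ hIBb₁ hIBb₂ hIua hIub
  have hID : IntervalIntegrable (fun u => Real.exp (γ * u / 4)
      * (4 * u * (a₁ u ^ 2 + b₁ u ^ 2) + m ^ 2 / u * (a u ^ 2 + b u ^ 2))) volume 0 U := by
    have e : (fun u => Real.exp (γ * u / 4) * (4 * u * (a₁ u ^ 2 + b₁ u ^ 2) + m ^ 2 / u * (a u ^ 2 + b u ^ 2)))
        = fun u => Real.exp (γ * u / 4) * (4 * u * (a₁ u ^ 2 + b₁ u ^ 2))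
          + Real.exp (γ * u / 4) * (m ^ 2 / u * (a u ^ 2 + b u ^ 2)) := by funext u; ring
    rw [e]; exact hID₁.add hID₂
  have hRe := core_dissipation_trunc hγ hm hRc0.le hu₁0 hu₁U ha hb hφa hφb hΦac hΦbc hPac hPbc hφa0 hφb0
    hdera hderb hderφa hderφb hΦa hΦb hPa hPb hφaU hφbU hIΩ hIE hIg hID hIaφ hIbφ hIBa₁ hIBa₂ hIBb₁ hIBb₂ hIua hIub hIcross
  have hID₁' := intervalIntegrable_mono_left hu₁0 hu₁U hID₁
  have hID₂' := intervalIntegrable_mono_left hu₁0 hu₁U hID₂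
  have hDsplit : ∫ u in (0:ℝ)..u₁, Real.exp (γ * u / 4) * (4 * u * (a₁ u ^ 2 + b₁ u ^ 2) + m ^ 2 / u * (a u ^ 2 + b u ^ 2))
      = (∫ u in (0:ℝ)..u₁, Real.exp (γ * u / 4) * (4 * u * (a₁ u ^ 2 + b₁ u ^ 2)))
        + ∫ u in (0:ℝ)..u₁, Real.exp (γ * u / 4) * (m ^ 2 / u * (a u ^ 2 + b u ^ 2)) := by
    rw [← integral_add hID₁' hID₂']; congr 1; funext u; ring
  rw [hDsplit] at hRe
  -- names (introduced AFTER hIm/hRe so that they are folded there)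
  set B₁ : ℝ := Real.exp (γ * u₁ / 4) * (a u₁ * (4 * u₁ * b₁ u₁ + γ * u₁ * b u₁) - b u₁ * (4 * u₁ * a₁ u₁ + γ * u₁ * a u₁)) with hB₁def
  set B₂ : ℝ := Real.exp (γ * u₁ / 4) * (a u₁ * (4 * u₁ * a₁ u₁ + γ * u₁ * a u₁) + b u₁ * (4 * u₁ * b₁ u₁ + γ * u₁ * b u₁)
      - γ * u₁ * (a u₁ ^ 2 + b u₁ ^ 2)) with hB₂def
  set X : ℝ := ∫ u in u₁..U, u * (a u ^ 2 + b u ^ 2) with hXdef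
  set 𝒞 : ℝ := ∫ u in (0:ℝ)..u₁, Real.exp (γ * u / 4)
      * ((1 - Real.exp (-(γ * u / 4))) / (2 * Real.pi * u)) * (a u ^ 2 + b u ^ 2) with h𝒞def
  set IE : ℝ := ∫ u in (0:ℝ)..u₁, Real.exp (γ * u / 4) * (a u ^ 2 + b u ^ 2) with hIEdef
  set I₄ : ℝ := ∫ u in (0:ℝ)..u₁, Real.exp (γ * u / 4) / (1 + u) ^ 4 with hI₄def
  set D : ℝ := ∫ u in (0:ℝ)..u₁, Real.exp (γ * u / 4) * (4 * u * (a₁ u ^ 2 + b₁ u ^ 2)) with hDdef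
  set D₂ : ℝ := ∫ u in (0:ℝ)..u₁, Real.exp (γ * u / 4) * (m ^ 2 / u * (a u ^ 2 + b u ^ 2)) with hD₂def
  have hIΩ' := intervalIntegrable_mono_left hu₁0 hu₁U hIΩ
  have hIE' := intervalIntegrable_mono_left hu₁0 hu₁U hIE
  have hIf' := intervalIntegrable_mono_left hu₁0 hu₁U hIf
  have hIg' := intervalIntegrable_mono_left hu₁0 hu₁U hIg
  have h𝒞0 : 0 ≤ 𝒞 := integral_nonneg hu₁0 (fun u hu => by
    have h1 : 0 ≤ 1 - Real.exp (-(γ * u / 4)) := by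
      have : Real.exp (-(γ * u / 4)) ≤ 1 := Real.exp_le_one_iff.mpr (by nlinarith [hu.1, hγ])
      linarith
    have := hu.1
    positivity)
  have hIE0 : 0 ≤ IE := integral_nonneg hu₁0 (fun u _ => by positivity)
  have hD0 : 0 ≤ D := integral_nonneg hu₁0 (fun u hu => by have := hu.1; positivity)
  have hD₂0 : 0 ≤ D₂ := integral_nonneg hu₁0 (fun u hu => by have := hu.1; positivity)
  have hI₄c : ContinuousOn (fun u : ℝ => Real.exp (γ * u / 4) / (1 + u) ^ 4) (Icc 0 u₁) := by
    apply ContinuousOn.div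
    · exact (Real.continuous_exp.comp (by continuity)).continuousOn
    · exact (continuousOn_const.add continuousOn_id).pow 4
    · intro u hu; have := hu.1; positivity
  have hI₄int : IntervalIntegrable (fun u : ℝ => Real.exp (γ * u / 4) / (1 + u) ^ 4) volume 0 u₁ :=
    hI₄c.intervalIntegrable_of_Icc hu₁0
  have hI₄0 : 0 ≤ I₄ := integral_nonneg hu₁0 (fun u hu => by have := hu.1; positivity)
  have hI₄ : I₄ ≤ u₁ * Real.exp (γ * u₁ / 4) := by
    have h1 : I₄ ≤ ∫ _ in (0:ℝ)..u₁, Real.exp (γ * u₁ / 4) := by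
      apply integral_mono_on hu₁0 hI₄int _root_.intervalIntegrable_const
      intro u hu
      have hE : Real.exp (γ * u / 4) ≤ Real.exp (γ * u₁ / 4) := Real.exp_le_exp.mpr (by nlinarith [hu.2, hγ])
      have h1u : 1 ≤ (1 + u) ^ 4 := one_le_pow₀ (by linarith [hu.1])
      calc Real.exp (γ * u / 4) / (1 + u) ^ 4 ≤ Real.exp (γ * u / 4) / 1 :=
            div_le_div_of_nonneg_left (Real.exp_pos _).le one_pos h1u
        _ ≤ Real.exp (γ * u₁ / 4) := by simpa using hE
    rw [intervalIntegral.integral_const, smul_eq_mul] at h1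
    linarith
  -- (P) `IE ≤ K 𝒞`
  have hP : IE ≤ K * 𝒞 := by
    rw [hIEdef, h𝒞def, ← intervalIntegral.integral_const_mul]
    apply integral_mono_on hu₁0 hIE' (hIΩ'.const_mul _)
    intro u hu
    rcases eq_or_lt_of_le hu.1 with h | h
    · subst h; simp [ha0, hb0]
    · have hs : 0 ≤ a u ^ 2 + b u ^ 2 := by positivity
      have h1 := exp_le_rot_weight hγ h hs
      have h2 : 2 * Real.pi * (u + 4 / γ) ≤ K := by rw [hKdef]; nlinarith [hu.2, hπ]
      have h3 : 0 ≤ Real.exp (γ * u / 4) * ((1 - Real.exp (-(γ * u / 4))) / (2 * Real.pi * u)) * (a u ^ 2 + b u ^ 2) := by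
        have h4 : 0 ≤ 1 - Real.exp (-(γ * u / 4)) := by
          have : Real.exp (-(γ * u / 4)) ≤ 1 := Real.exp_le_one_iff.mpr (by nlinarith [hγ, h])
          linarith
        positivity
      exact h1.trans (mul_le_mul_of_nonneg_right h2 h3)
  -- pointwise AM–GM for the forcing pairings, integrated over `[0, u₁]`
  have hpair : ∀ η : ℝ, 0 < η →
      (∫ u in (0:ℝ)..u₁, Real.exp (γ * u / 4) * (a u * f₂ u - b u * f₁ u)) ≤ η / 2 * IE + M ^ 2 * I₄ / η ∧
      (∫ u in (0:ℝ)..u₁, Real.exp (γ * u / 4) * (a u * f₁ u + b u * f₂ u)) ≤ η / 2 * IE + M ^ 2 * I₄ / η := by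
    intro η hη
    have hrhs : IntervalIntegrable (fun u => η / 2 * (Real.exp (γ * u / 4) * (a u ^ 2 + b u ^ 2))
        + M ^ 2 / η * (Real.exp (γ * u / 4) / (1 + u) ^ 4)) volume 0 u₁ :=
      (hIE'.const_mul _).add (hI₄int.const_mul _)
    have hrhs_val : ∫ u in (0:ℝ)..u₁, (η / 2 * (Real.exp (γ * u / 4) * (a u ^ 2 + b u ^ 2))
        + M ^ 2 / η * (Real.exp (γ * u / 4) / (1 + u) ^ 4)) = η / 2 * IE + M ^ 2 * I₄ / η := by
      rw [integral_add (hIE'.const_mul _) (hI₄int.const_mul _), intervalIntegral.integral_const_mul,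
        intervalIntegral.integral_const_mul, hIEdef, hI₄def]
      ring
    have hpt : ∀ u ∈ Icc 0 u₁,
        Real.exp (γ * u / 4) * (a u * f₂ u - b u * f₁ u)
          ≤ η / 2 * (Real.exp (γ * u / 4) * (a u ^ 2 + b u ^ 2)) + M ^ 2 / η * (Real.exp (γ * u / 4) / (1 + u) ^ 4) ∧
        Real.exp (γ * u / 4) * (a u * f₁ u + b u * f₂ u)
          ≤ η / 2 * (Real.exp (γ * u / 4) * (a u ^ 2 + b u ^ 2)) + M ^ 2 / η * (Real.exp (γ * u / 4) / (1 + u) ^ 4) := by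
      intro u hu
      have hu' : u ∈ Icc 0 U := hsub hu
      have h1u : 0 < (1 + u) ^ 2 := by have := hu.1; positivity
      have hg₁ : |f₁ u| ≤ M / (1 + u) ^ 2 := by rw [le_div_iff₀ h1u]; linarith [hf₁ u hu']
      have hg₂ : |f₂ u| ≤ M / (1 + u) ^ 2 := by rw [le_div_iff₀ h1u]; linarith [hf₂ u hu']
      obtain ⟨hA, hB⟩ := pairing_amgm (a := a u) (b := b u) hη hg₁ hg₂
      have hE0 : 0 ≤ Real.exp (γ * u / 4) := (Real.exp_pos _).le
      have e : Real.exp (γ * u / 4) * (η / 2 * (a u ^ 2 + b u ^ 2) + (M / (1 + u) ^ 2) ^ 2 / η)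
          = η / 2 * (Real.exp (γ * u / 4) * (a u ^ 2 + b u ^ 2)) + M ^ 2 / η * (Real.exp (γ * u / 4) / (1 + u) ^ 4) := by
        field_simp
      constructor
      · have := mul_le_mul_of_nonneg_left hB hE0; linarith
      · have := mul_le_mul_of_nonneg_left hA hE0; linarith
    constructor
    · rw [← hrhs_val]; exact integral_mono_on hu₁0 hIf' hrhs (fun u hu => (hpt u hu).1)
    · rw [← hrhs_val]; exact integral_mono_on hu₁0 hIg' hrhs (fun u hu => (hpt u hu).2)
  -- (Im) algebra with remainder `Z = B₁ + (γ²Rc/16πm) X`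
  have hIm' : c₁ * Rc * 𝒞 + m * ρ * IE
      ≤ (∫ u in (0:ℝ)..u₁, Real.exp (γ * u / 4) * (a u * f₂ u - b u * f₁ u)) + (B₁ + γ ^ 2 * Rc / (16 * Real.pi * m) * X) := by
    have e : (1 - 16 / (5 * m ^ 2)) * (m * Rc) * 𝒞 = c₁ * Rc * 𝒞 := by rw [hc₁def]; ring
    rw [← e]; linarith [hIm]
  have hρK : m * |ρ| * K ≤ c₁ * Rc / 4 := by
    have h1 : |ρ| * K ≤ Rc / 20 := by
      rw [hKdef]
      have : 40 * Real.pi * |ρ| * (u₁ + 4 / γ) = 20 * (|ρ| * (2 * Real.pi * (u₁ + 4 / γ))) := by ring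
      linarith [hρ]
    have h2 : m * |ρ| * K ≤ m * (Rc / 20) := by
      have := mul_le_mul_of_nonneg_left h1 hm0.le; linarith [mul_assoc m (|ρ|) K]
    nlinarith [hc₁m]
  have hη : 0 < c₁ * Rc / K := by positivity
  have hrot := (hpair (c₁ * Rc / K) hη).1
  have h𝒞 : 𝒞 ≤ 4 * K * (M ^ 2 * I₄) / (c₁ ^ 2 * Rc ^ 2) + 4 * (B₁ + γ ^ 2 * Rc / (16 * Real.pi * m) * X) / (c₁ * Rc) :=
    gauss_currency_bound_rem hK hc₁ hRc0 hm0 h𝒞0 hIE0 hP hIm' hrot hρK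
  -- (Re) algebra with remainder `W = B₂ + (γ²Rc/16πm) X`
  have hRe' : D + D₂ ≤ γ * IE + (∫ u in (0:ℝ)..u₁, Real.exp (γ * u / 4) * (a u * f₁ u + b u * f₂ u))
      + 16 / (5 * m) * Rc * 𝒞 + (B₂ + γ ^ 2 * Rc / (16 * Real.pi * m) * X) := by linarith [hRe]
  have hdis := (hpair (2 * Rc) (by positivity)).2
  have hDD := gauss_dissipation_bound_rem hK hc₁ hRc hγ hm h𝒞0 hRe' hP hdis h𝒞
  -- export
  have htarget : D + D₂ ≤ M ^ 2 * (u₁ * Real.exp (γ * u₁ / 4)) / Rc * (4 * K * ((γ + 1) * K + 4) / c₁ ^ 2 + 1 / 2)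
      + 4 * ((γ + 1) * K + 4) * B₁ / c₁ + B₂
      + γ ^ 2 * Rc / (16 * Real.pi * m) * (1 + 4 * ((γ + 1) * K + 4) / c₁) * X := by
    have hA : M ^ 2 * I₄ / Rc ≤ M ^ 2 * (u₁ * Real.exp (γ * u₁ / 4)) / Rc :=
      div_le_div_of_nonneg_right (mul_le_mul_of_nonneg_left hI₄ (by positivity)) hRc0.le
    have hB0 : 0 ≤ 4 * K * ((γ + 1) * K + 4) / c₁ ^ 2 + 1 / 2 := by positivity
    have h1 := mul_le_mul_of_nonneg_right hA hB0
    have e : 4 * ((γ + 1) * K + 4) * (B₁ + γ ^ 2 * Rc / (16 * Real.pi * m) * X) / c₁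
        + (B₂ + γ ^ 2 * Rc / (16 * Real.pi * m) * X)
        = 4 * ((γ + 1) * K + 4) * B₁ / c₁ + B₂ + γ ^ 2 * Rc / (16 * Real.pi * m) * (1 + 4 * ((γ + 1) * K + 4) / c₁) * X := by
      field_simp
      ring
    linarith [hDD, h1, e]
  have h𝒞' : 𝒞 ≤ 4 * K * (M ^ 2 * (u₁ * Real.exp (γ * u₁ / 4))) / (c₁ ^ 2 * Rc ^ 2)
      + 4 * (B₁ + γ ^ 2 * Rc / (16 * Real.pi * m) * X) / (c₁ * Rc) := by
    have hA : 4 * K * (M ^ 2 * I₄) / (c₁ ^ 2 * Rc ^ 2) ≤ 4 * K * (M ^ 2 * (u₁ * Real.exp (γ * u₁ / 4))) / (c₁ ^ 2 * Rc ^ 2) := by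
      apply div_le_div_of_nonneg_right _ (by positivity)
      exact mul_le_mul_of_nonneg_left (mul_le_mul_of_nonneg_left hI₄ (by positivity)) (by positivity)
    linarith [h𝒞]
  have hIE' : IE ≤ K * (4 * K * (M ^ 2 * (u₁ * Real.exp (γ * u₁ / 4))) / (c₁ ^ 2 * Rc ^ 2)
      + 4 * (B₁ + γ ^ 2 * Rc / (16 * Real.pi * m) * X) / (c₁ * Rc)) :=
    hP.trans (mul_le_mul_of_nonneg_left h𝒞' hK.le)
  refine ⟨?_, ?_⟩
  · simpa [hKdef, hc₁def, hB₁def, hXdef, hIEdef] using hIE'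
  · simpa [hKdef, hc₁def, hB₁def, hB₂def, hXdef, hDdef, hD₂def] using htarget

end Summit.NavierStokesRegularity.NavierStokesRegularity.Theorems.DefectColumnGate

end
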